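import Mathlib
import Summits.MatrixMultiplication.MatrixMultiplication.Theorems.SnSubsetDichotomyHyperoctahedralThresholdPatternRefl
import Summits.MatrixMultiplication.MatrixMultiplication.Theorems.SnSubsetDichotomyHyperoctahedralThresholdTwinSupply
import Summits.MatrixMultiplication.MatrixMultiplication.Theorems.SnSubsetDichotomyHyperoctahedralThresholdCleanReflection

/-!
# `SnSubsetDichotomy.HyperoctahedralThreshold` — involutive twins; cyclic reduction with a forbidden set

Helper file for crux `stmt-MatrixMultiplication-10883` (line `refutation-local-symmetry`, open core
`stub_poorRigidCore`; siege seat k25, variation "supply/tip dichotomy").  Companion file: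
`SnSubsetDichotomyHyperoctahedralThresholdNearSymmetry` (near-symmetric hosts satisfy the core), which uses both
results below.

Setting (the line's vocabulary): three involutions `μ 0, μ 1, μ 2` of `Fin n`; colour words `z : List (Fin 3)` act on
the right, `v · z = z.foldl (fun v c => μ c v) v`; "reduced" is `List.IsChain (· ≠ ·) z`, "cyclically reduced" is
`List.IsChain (· ≠ ·) (z ++ z)`; the trajectory of `x` under `z` is `t ↦ x_t := x · z.take t`.

* `involutiveTwin_cleanWalk` — the exact characterisation of clean twin-type rung walks: two fixed points `x, y` of a
  cyclically reduced `z` give clean closed-rung-walk data `t ↦ {x_t, y_t}` in the output format of the core iff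
  `x_t ≠ y_t`, the SELF-patterns agree (`x_s = x_t ↔ y_s = y_t`) and the CROSS-pattern is symmetric
  (`x_s = y_t ↔ y_s = x_t`), i.e. iff `x_t ↦ y_t, y_t ↦ x_t` is a well-defined fixed-point-free involution of the two
  trajectories.  Symmetric cross-coincidences — "slides" (crux NOTES §§4, 11) occurring together with their reverse —
  are NOT defects.  Contains the three pattern-level extraction lemmas of siege seat k20 (`stub_patternPair`: no
  cross-coincidences; `stub_patternRefl`: `y = μ z[0] x`, the mirror trajectory; `stub_patternHalfTurn`: `y = x · w` for
  `z = w ++ w`) as the special cases produced by global symmetries.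
* `NearSymmetry.cyclic_of_closed_avoiding`, `NearSymmetry.cyclic_of_collision_avoiding` — the free + cyclic
  reduction of a closed reduced word / of a collision of two distinct reduced words (the inductions of
  `TwinSupply.cyclic_of_closed` / `cyclic_of_collision`, siege seat k5) CARRYING A FORBIDDEN SET: the trajectory of
  the resulting cyclically reduced closed walk consists of trajectory points of the input words, so it avoids whatever
  they avoid.  This is the `R`-bookkeeping every supply needs before it can feed the one-gadget-with-`R` core.

Registered form: `stub_involutiveTwin` (verbatim wrapper).  Pure finite combinatorics. [folklore]
-/

-- the project's summit namespace `Summit.MatrixMultiplication.MatrixMultiplication` repeats a component by design (D-0022)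

set_option linter.dupNamespace false

namespace Summit.MatrixMultiplication.MatrixMultiplication.Theorems.HyperoctahedralThreshold

open Equiv


/-- **Involutive twins are clean.**  Let `μ c` be permutations of `Fin n`, `z` a cyclically reduced colour
word of length `ℓ ≥ 2`, and `x, y` two fixed points of `z` (trajectories `x_t := x · z.take t`, `y_t := y · z.take t`,
`t < ℓ`) such that
* the two trajectories never occupy the same point at the same time (`x_t ≠ y_t`),
* they have the same SELF-coincidence pattern (`x_s = x_t ↔ y_s = y_t`), and
* their CROSS-coincidence pattern is symmetric (`x_s = y_t ↔ y_s = x_t`),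
and both avoid `R`.  Then `p t := x_t`, `q t := y_t`, `col t := z[t]` (`t : Fin (k+1)`, `k + 1 = ℓ`) is clean
closed-rung-walk data in the output format of the line's core (side-preserving steps, cyclically distinct
consecutive colours, rungs pairwise EQUAL OR DISJOINT, all points outside `R`).  The three hypotheses say exactly
that `x_t ↦ y_t, y_t ↦ x_t` is a well-defined fixed-point-free involution of the union of the two trajectories,
and they are also necessary; so this is the exact characterisation of clean twin-type rung walks.  It contains
the landed `stub_patternPair` (no cross-coincidences at all), `stub_patternRefl` (`y = μ z[0] x`, the mirror
trajectory) and `stub_patternHalfTurn` (`y = x · w` for `z = w ++ w`) of siege seat k20 as the three special cases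
global symmetries produce, and it is the extraction step of `nearSymmetry_cleanWalk` below. [folklore] -/
theorem involutiveTwin_cleanWalk (n : ℕ) (μ : Fin 3 → Equiv.Perm (Fin n)) (R : Finset (Fin n))
    (z : List (Fin 3)) (x y : Fin n) (hlen : 2 ≤ z.length) (hchain : List.IsChain (· ≠ ·) (z ++ z))
    (hfx : z.foldl (fun v c => μ c v) x = x) (hfy : z.foldl (fun v c => μ c v) y = y)
    (hne : ∀ t : Fin z.length,
      (z.take (t : ℕ)).foldl (fun v c => μ c v) x ≠ (z.take (t : ℕ)).foldl (fun v c => μ c v) y)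
    (hpat : ∀ s t : Fin z.length,
      ((z.take (s : ℕ)).foldl (fun v c => μ c v) x = (z.take (t : ℕ)).foldl (fun v c => μ c v) x ↔
        (z.take (s : ℕ)).foldl (fun v c => μ c v) y = (z.take (t : ℕ)).foldl (fun v c => μ c v) y))
    (hcross : ∀ s t : Fin z.length,
      ((z.take (s : ℕ)).foldl (fun v c => μ c v) x = (z.take (t : ℕ)).foldl (fun v c => μ c v) y ↔
        (z.take (s : ℕ)).foldl (fun v c => μ c v) y = (z.take (t : ℕ)).foldl (fun v c => μ c v) x))
    (hRx : ∀ t : Fin z.length, (z.take (t : ℕ)).foldl (fun v c => μ c v) x ∉ R)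
    (hRy : ∀ t : Fin z.length, (z.take (t : ℕ)).foldl (fun v c => μ c v) y ∉ R) :
    ∃ (k : ℕ) (p q : Fin (k + 1) → Fin n) (col : Fin (k + 1) → Fin 3), (∀ i, p i ≠ q i) ∧
      (∀ i, (μ (col i) (p i) = p (i + 1) ∧ μ (col i) (q i) = q (i + 1)) ∨
        (μ (col i) (p i) = q (i + 1) ∧ μ (col i) (q i) = p (i + 1))) ∧
      (∀ i, col i ≠ col (i + 1)) ∧
      (∀ i j, (p i = p j ∧ q i = q j) ∨ (p i = q j ∧ q i = p j) ∨
        (p i ≠ p j ∧ p i ≠ q j ∧ q i ≠ p j ∧ q i ≠ q j)) ∧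
      (∀ i, p i ∉ R ∧ q i ∉ R) ∧ k + 1 = z.length := by
  classical
  obtain ⟨k, hk⟩ : ∃ k, k + 1 = z.length := ⟨z.length - 1, by omega⟩
  have hlt : ∀ i : Fin (k + 1), (i : ℕ) < z.length := fun i => i.isLt.trans_eq hk
  have hval : ∀ i : Fin (k + 1), ((i + 1 : Fin (k + 1)) : ℕ) = ((i : ℕ) + 1) % z.length :=
    fun i => by
      rw [PatternTwin.val_add_one]
      exact congrArg (fun N => ((i : ℕ) + 1) % N) hk
  refine ⟨k, fun i => (z.take i).foldl (fun v c => μ c v) x,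
    fun i => (z.take i).foldl (fun v c => μ c v) y, fun i => z[(i : ℕ)]'(hlt i),
    ?_, ?_, ?_, ?_, ?_, hk⟩
  · -- the two ends of every rung differ
    intro i
    exact hne ⟨i, hlt i⟩
  · -- side-preserving steps on both trajectories
    intro i
    refine Or.inl ⟨?_, ?_⟩
    · show μ (z[(i : ℕ)]'(hlt i)) ((z.take i).foldl (fun v c => μ c v) x) =
        (z.take ((i + 1 : Fin (k + 1)) : ℕ)).foldl (fun v c => μ c v) x
      rw [hval i]
      exact GoodTwin.foldl_take_step μ z x hfx i (hlt i)
    · show μ (z[(i : ℕ)]'(hlt i)) ((z.take i).foldl (fun v c => μ c v) y) =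
        (z.take ((i + 1 : Fin (k + 1)) : ℕ)).foldl (fun v c => μ c v) y
      rw [hval i]
      exact GoodTwin.foldl_take_step μ z y hfy i (hlt i)
  · -- consecutive colours differ, cyclically
    intro i
    exact GoodTwin.cyclic_ne hchain i _ (hlt i) (hlt (i + 1)) (hval i)
  · -- rungs are pairwise equal or disjoint
    intro i j
    have hij := hpat ⟨i, hlt i⟩ ⟨j, hlt j⟩
    have hcij := hcross ⟨i, hlt i⟩ ⟨j, hlt j⟩
    by_cases h1 : (z.take i).foldl (fun v c => μ c v) x = (z.take j).foldl (fun v c => μ c v) x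
    · exact Or.inl ⟨h1, hij.1 h1⟩
    · by_cases h2 : (z.take i).foldl (fun v c => μ c v) x = (z.take j).foldl (fun v c => μ c v) y
      · exact Or.inr (Or.inl ⟨h2, hcij.1 h2⟩)
      · exact Or.inr (Or.inr ⟨h1, h2, fun h => h2 (hcij.2 h), fun h => h1 (hij.2 h)⟩)
  · -- both trajectories avoid `R`
    intro i
    exact ⟨hRx ⟨i, hlt i⟩, hRy ⟨i, hlt i⟩⟩


namespace NearSymmetry

variable {n : ℕ}

/-! ### Cyclic reduction carrying the trajectory (cf. `TwinSupply.cyclic_of_closed` / `cyclic_of_collision`, p112567,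
which are the same inductions without the forbidden-set bookkeeping; one-letter facts are taken from the sibling files
`PatternRefl.inv_apply_apply`, `TwinSupply.foldl_act_concat`, `CleanReflection.act_reverse(_take)`) -/

/-- **Cyclic reduction with a forbidden set.**  A non-empty reduced word `t` closing at `p` (fixed-point-free
involutions) whose trajectory from `p` avoids `S` conjugates to a non-empty CYCLICALLY reduced word `z` closing at
`p · u`, `|z| + 2|u| ≤ |t|`, whose trajectory from `p · u` again avoids `S` (it consists of trajectory points of `t`).
[folklore] -/
theorem cyclic_of_closed_avoiding (μ : Fin 3 → Perm (Fin n)) (hμ : ∀ c, μ c * μ c = 1)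
    (hfpf : ∀ c v, μ c v ≠ v) (S : Finset (Fin n)) :
    ∀ (N : ℕ) (t : List (Fin 3)) (p : Fin n), t.length ≤ N → t ≠ [] → List.IsChain (· ≠ ·) t →
      t.foldl (fun v c => μ c v) p = p → (∀ i : ℕ, (t.take i).foldl (fun v c => μ c v) p ∉ S) →
      ∃ u z : List (Fin 3), z ≠ [] ∧ List.IsChain (· ≠ ·) (z ++ z) ∧ z.length + 2 * u.length ≤ t.length ∧
        z.foldl (fun v c => μ c v) (u.foldl (fun v c => μ c v) p) = u.foldl (fun v c => μ c v) p ∧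
        ∀ i : ℕ, (z.take i).foldl (fun v c => μ c v) (u.foldl (fun v c => μ c v) p) ∉ S := by
  intro N
  induction N with
  | zero =>
    intro t p hN ht
    exact absurd (List.eq_nil_of_length_eq_zero (Nat.le_zero.1 hN)) ht
  | succ N ih =>
    intro t p hN ht hc hp hS
    obtain ⟨d, t₁, rfl⟩ := List.exists_cons_of_ne_nil ht
    rcases List.eq_nil_or_concat t₁ with h1 | ⟨m, e, h1⟩
    · subst h1
      exact absurd hp (hfpf d p)
    · rw [List.concat_eq_append] at h1
      subst h1
      by_cases hde : d = e
      · subst hde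
        -- `t = d :: (m ++ [d])`: strip both ends and recurse on `m` at the transported point
        have hm : m ≠ [] := by
          rintro rfl
          have := hc
          simp at this
        have hcm : List.IsChain (· ≠ ·) m :=
          (List.isChain_cons.1 hc).2.left_of_append
        have key : m.foldl (fun v c => μ c v) (μ d p) = μ d p := by
          rw [List.foldl_cons, TwinSupply.foldl_act_concat] at hp
          have := congrArg (μ d) hp
          rwa [PatternRefl.inv_apply_apply μ hμ] at this
        have hlen : m.length ≤ N := by
          simp only [List.length_cons, List.length_append] at hN
          omega
        have hSm : ∀ i : ℕ, (m.take i).foldl (fun v c => μ c v) (μ d p) ∉ S := by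
          intro i
          by_cases hi : i ≤ m.length
          · have h := hS (i + 1)
            rwa [List.take_succ_cons, List.foldl_cons, List.take_append_of_le_length hi] at h
          · rw [List.take_of_length_le (le_of_lt (not_le.mp hi)), key]
            have h := hS 1
            rwa [List.take_succ_cons, List.take_zero, List.foldl_cons, List.foldl_nil] at h
        obtain ⟨u, z, hz0, hzc, hzl, hzp, hzS⟩ := ih m (μ d p) hlen hm hcm key hSm
        refine ⟨d :: u, z, hz0, hzc, ?_, ?_, ?_⟩
        · simp only [List.length_cons, List.length_append]
          omega
        · simpa only [List.foldl_cons] using hzp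
        · simpa only [List.foldl_cons] using hzS
      · -- first and last letters differ: `t` itself is cyclically reduced
        refine ⟨[], d :: (m ++ [e]), by simp, ?_, by simp, by simpa using hp, by simpa using hS⟩
        refine List.isChain_append.2 ⟨hc, hc, ?_⟩
        intro x hx y hy
        rw [← List.cons_append, List.getLast?_concat, Option.mem_def, Option.some.injEq] at hx
        rw [List.head?_cons, Option.mem_def, Option.some.injEq] at hy
        rw [← hx, ← hy]
        exact fun h => hde h.symm

/-- **Collision ⇒ cyclically reduced closed walk, with a forbidden set.**  Two DISTINCT reduced words `t ≠ t'`
with the same action on `p`, both of whose trajectories from `p` avoid `S`, yield a non-empty cyclically reduced `z`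
closing at `p · u`, `|z| + 2|u| ≤ |t| + |t'|`, whose trajectory from `p · u` avoids `S`: strip the common suffix,
strip the common prefix (moving the base point along it), and when both ends differ close up `z := t ++ t'.reverse`
(walking back along `t'` revisits the trajectory of `t'`, `CleanReflection.act_reverse_take`); an exhausted word leaves a closed
one, `cyclic_of_closed_avoiding`. [folklore] -/
theorem cyclic_of_collision_avoiding (μ : Fin 3 → Perm (Fin n)) (hμ : ∀ c, μ c * μ c = 1)
    (hfpf : ∀ c v, μ c v ≠ v) (S : Finset (Fin n)) :
    ∀ (N : ℕ) (t t' : List (Fin 3)) (p : Fin n), t.length + t'.length ≤ N → t ≠ t' →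
      List.IsChain (· ≠ ·) t → List.IsChain (· ≠ ·) t' →
      t.foldl (fun v c => μ c v) p = t'.foldl (fun v c => μ c v) p →
      (∀ i : ℕ, (t.take i).foldl (fun v c => μ c v) p ∉ S) →
      (∀ i : ℕ, (t'.take i).foldl (fun v c => μ c v) p ∉ S) →
      ∃ u z : List (Fin 3), z ≠ [] ∧ List.IsChain (· ≠ ·) (z ++ z) ∧
        z.length + 2 * u.length ≤ t.length + t'.length ∧
        z.foldl (fun v c => μ c v) (u.foldl (fun v c => μ c v) p) = u.foldl (fun v c => μ c v) p ∧
        ∀ i : ℕ, (z.take i).foldl (fun v c => μ c v) (u.foldl (fun v c => μ c v) p) ∉ S := by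
  intro N
  induction N with
  | zero =>
    intro t t' p hN htt
    have h1 : t = [] := List.eq_nil_of_length_eq_zero (by omega)
    have h2 : t' = [] := List.eq_nil_of_length_eq_zero (by omega)
    exact absurd (h1.trans h2.symm) htt
  | succ N ih =>
    intro t t' p hN htt hc hc' hp hS hS'
    -- one of the two words exhausted: the other closes at `p`
    by_cases ht0 : t = []
    · subst ht0
      have ht' : t' ≠ [] := fun h => htt h.symm
      obtain ⟨u, z, h1, h2, h3, h4, h5⟩ :=
        cyclic_of_closed_avoiding μ hμ hfpf S (N + 1) t' p (by simpa using hN) ht' hc' hp.symm hS'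
      exact ⟨u, z, h1, h2, by simpa using h3, h4, h5⟩
    by_cases ht0' : t' = []
    · subst ht0'
      obtain ⟨u, z, h1, h2, h3, h4, h5⟩ :=
        cyclic_of_closed_avoiding μ hμ hfpf S (N + 1) t p (by simpa using hN) ht0 hc hp hS
      exact ⟨u, z, h1, h2, by simpa using h3, h4, h5⟩
    -- both non-empty: compare last letters
    obtain ⟨t₂, e, hte⟩ : ∃ t₂ e, t = t₂ ++ [e] := by
      rcases List.eq_nil_or_concat t with h | ⟨t₂, e, h⟩
      · exact absurd h ht0
      · exact ⟨t₂, e, by rw [h, List.concat_eq_append]⟩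
    obtain ⟨t₂', e', hte'⟩ : ∃ t₂' e', t' = t₂' ++ [e'] := by
      rcases List.eq_nil_or_concat t' with h | ⟨t₂', e', h⟩
      · exact absurd h ht0'
      · exact ⟨t₂', e', by rw [h, List.concat_eq_append]⟩
    by_cases hee : e = e'
    · subst hee hte hte'
      have strip : t₂.foldl (fun v c => μ c v) p = t₂'.foldl (fun v c => μ c v) p := by
        rw [TwinSupply.foldl_act_concat, TwinSupply.foldl_act_concat] at hp
        exact (μ e).injective hp
      have hne : t₂ ≠ t₂' := fun h => htt (by rw [h])
      have hlen : t₂.length + t₂'.length ≤ N := by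
        simp only [List.length_append, List.length_singleton] at hN; omega
      have pre : ∀ (s : List (Fin 3)), (∀ i : ℕ, ((s ++ [e]).take i).foldl (fun v c => μ c v) p ∉ S) →
          ∀ i : ℕ, (s.take i).foldl (fun v c => μ c v) p ∉ S := by
        intro s hs i
        by_cases hi : i ≤ s.length
        · have h := hs i
          rwa [List.take_append_of_le_length hi] at h
        · have h := hs s.length
          rw [List.take_append_of_le_length le_rfl, List.take_length] at h
          rwa [List.take_of_length_le (le_of_lt (not_le.mp hi))]
      obtain ⟨u, z, h1, h2, h3, h4, h5⟩ := ih t₂ t₂' p hlen hne hc.left_of_append hc'.left_of_append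
        strip (pre t₂ hS) (pre t₂' hS')
      exact ⟨u, z, h1, h2, by simp only [List.length_append, List.length_singleton]; omega, h4, h5⟩
    -- last letters differ: compare first letters
    obtain ⟨d, t₁, htd⟩ := List.exists_cons_of_ne_nil ht0
    obtain ⟨d', t₁', htd'⟩ := List.exists_cons_of_ne_nil ht0'
    by_cases hdd : d = d'
    · subst hdd htd htd'
      rw [List.foldl_cons, List.foldl_cons] at hp
      have hne : t₁ ≠ t₁' := fun h => htt (by rw [h])
      have hlen : t₁.length + t₁'.length ≤ N := by
        simp only [List.length_cons] at hN; omega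
      have post : ∀ (s : List (Fin 3)), (∀ i : ℕ, ((d :: s).take i).foldl (fun v c => μ c v) p ∉ S) →
          ∀ i : ℕ, (s.take i).foldl (fun v c => μ c v) (μ d p) ∉ S := by
        intro s hs i
        have h := hs (i + 1)
        rwa [List.take_succ_cons, List.foldl_cons] at h
      obtain ⟨u, z, h1, h2, h3, h4, h5⟩ := ih t₁ t₁' (μ d p) hlen hne
        (List.isChain_cons.1 hc).2 (List.isChain_cons.1 hc').2 hp (post t₁ hS) (post t₁' hS')
      refine ⟨d :: u, z, h1, h2, ?_, by simpa only [List.foldl_cons] using h4,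
        by simpa only [List.foldl_cons] using h5⟩
      simp only [List.length_cons]; omega
    -- both ends differ: close up `z := t ++ t'.reverse`
    have hrev : (t ++ t'.reverse).foldl (fun v c => μ c v) p = p := by
      rw [List.foldl_append, hp]
      exact CleanReflection.act_reverse μ hμ t' p
    refine ⟨[], t ++ t'.reverse, by simp [ht0], ?_, by simp, by simpa using hrev, ?_⟩
    · have hcr : List.IsChain (· ≠ ·) t'.reverse :=
        List.isChain_reverse.2 (hc'.imp fun a b h => fun h' => h h'.symm)
      have hz : List.IsChain (· ≠ ·) (t ++ t'.reverse) := by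
        refine List.isChain_append.2 ⟨hc, hcr, ?_⟩
        intro x hx y hy
        rw [hte, List.getLast?_concat] at hx
        rw [List.head?_reverse, hte', List.getLast?_concat] at hy
        simp only [Option.mem_def, Option.some.injEq] at hx hy
        subst hx; subst hy
        exact hee
      refine List.isChain_append.2 ⟨hz, hz, ?_⟩
      intro x hx y hy
      have ht'r : t'.reverse ≠ [] := by simpa using ht0'
      rw [List.getLast?_append_of_ne_nil _ ht'r, List.getLast?_reverse, htd', List.head?_cons] at hx
      rw [List.head?_append, htd, List.head?_cons, Option.some_or] at hy
      simp only [Option.mem_def, Option.some.injEq] at hx hy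
      subst hx; subst hy
      exact fun h => hdd h.symm
    · -- the trajectory of `t ++ t'.reverse` from `p`: that of `t`, then that of `t'` backwards
      intro i
      rw [List.foldl_nil]
      by_cases hi : i ≤ t.length
      · rw [List.take_append_of_le_length hi]
        exact hS i
      · rw [List.take_append, List.take_of_length_le (le_of_lt (not_le.mp hi)), List.foldl_append, hp,
          CleanReflection.act_reverse_take μ hμ]
        exact hS' _

end NearSymmetry

/-! ## Registered form (`stub-add`ed on the crux item; signature verbatim) -/

/-- **Registered form `stub_involutiveTwin`** (crux `stmt-MatrixMultiplication-10883`, helper stub of siege seat k25):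
`involutiveTwin_cleanWalk` verbatim. [folklore] -/
theorem stub_involutiveTwin : ∀ (n : ℕ) (μ : Fin 3 → Equiv.Perm (Fin n)) (R : Finset (Fin n)) (z : List (Fin 3)) (x y : Fin n), 2 ≤ z.length → List.IsChain (· ≠ ·) (z ++ z) → z.foldl (fun v c => μ c v) x = x → z.foldl (fun v c => μ c v) y = y → (∀ t : Fin z.length, (z.take (t : ℕ)).foldl (fun v c => μ c v) x ≠ (z.take (t : ℕ)).foldl (fun v c => μ c v) y) → (∀ s t : Fin z.length, ((z.take (s : ℕ)).foldl (fun v c => μ c v) x = (z.take (t : ℕ)).foldl (fun v c => μ c v) x ↔ (z.take (s : ℕ)).foldl (fun v c => μ c v) y = (z.take (t : ℕ)).foldl (fun v c => μ c v) y)) → (∀ s t : Fin z.length, ((z.take (s : ℕ)).foldl (fun v c => μ c v) x = (z.take (t : ℕ)).foldl (fun v c => μ c v) y ↔ (z.take (s : ℕ)).foldl (fun v c => μ c v) y = (z.take (t : ℕ)).foldl (fun v c => μ c v) x)) → (∀ t : Fin z.length, (z.take (t : ℕ)).foldl (fun v c => μ c v) x ∉ R) → (∀ t : Fin z.length, (z.take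 (t : ℕ)).foldl (fun v c => μ c v) y ∉ R) → ∃ (k : ℕ) (p q : Fin (k + 1) → Fin n) (col : Fin (k + 1) → Fin 3), (∀ i, p i ≠ q i) ∧ (∀ i, (μ (col i) (p i) = p (i + 1) ∧ μ (col i) (q i) = q (i + 1)) ∨ (μ (col i) (p i) = q (i + 1) ∧ μ (col i) (q i) = p (i + 1))) ∧ (∀ i, col i ≠ col (i + 1)) ∧ (∀ i j, (p i = p j ∧ q i = q j) ∨ (p i = q j ∧ q i = p j) ∨ (p i ≠ p j ∧ p i ≠ q j ∧ q i ≠ p j ∧ q i ≠ q j)) ∧ (∀ i, p i ∉ R ∧ q i ∉ R) ∧ k + 1 = z.length :=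
  involutiveTwin_cleanWalk


end Summit.MatrixMultiplication.MatrixMultiplication.Theorems.HyperoctahedralThreshold
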